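import Summits.QuantumFields.BalabanUV.T4Continuum.Support.NE7TopMismatchLetters
import Summits.QuantumFields.BalabanUV.T4Continuum.Support.NE7QbarCurvedBaseBudget
import Summits.QuantumFields.BalabanUV.T4Continuum.Support.NE7FramePotCurvedL1
import Summits.QuantumFields.BalabanUV.T4Continuum.Support.NE3EnergyVary
import Summits.QuantumFields.BalabanUV.T4Continuum.Support.NE3QuadRemainderTower
import HarnessLib

/-!
# NE7TangentTransportSameTopDocked — THE (L4) LETTER OF THE CURVED (APE) FOR FIBRE-PRESERVING REPRESENTATIVES, FULLY EXPLICIT: for every skew periodic `Z` with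
# `‖Z‖ ≤ α₀` and `cavgIter (k+1) (W e^{Z}) = cavgIter (k+1) W`, every `W`-tangent `Y` has a `(We^{Z})`-tangent `Y′` with
# `|dAction (We^{Z}) (Y′ − Y)| ≤ x′·c₁·(M^d∕M²)·K_maj·(L∕L^d)^k·(C₁·L^k·(e^{α₀} − 1) + C₂·(L²)^k·x′)·‖Y‖_{ℓ¹}`, `x′ = x + 4(e^{α₀} − 1)` — F74 ∘ F73 ∘ F72; file 9 (the docked letter)

Cell `pub-balaban`, rung (B)+1 sub-cell t4, lineage `b2b-balaban-t4-ne7-p1` (CRUX PROVER NE7 #1 = OWNER of row NE7), generation 76; memo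
`t4/b2b-balaban-t4-ne7-p1-g76/TT-CURVED-LETTER.md` §1–§3.  File F75 (over F74 `NE7TopMismatchLetters.tangent_transport_sameTop_rightInvW`, F73
`NE7QbarCurvedBaseBudget.sum_norm_QbarIter_sub_QbarIter_le_budget`, F72 `NE7FramePotCurvedL1.sum_norm_framePotW_le_Kmaj`, row NE3's `NE3EnergyVary.smallField_vary`,
`AveragingDeficitPlaqDeriv.vary_isUnitaryCfg`, `NE3QuadRemainderTower.vary_add_period`, `AveragingDeficitMultiLevelPrep.LevelSmall.mono`).
WHY.  F66 `NE7ApeCurvedRepDockingStrong` displays `hTT` quantified over the Landau representatives `Z` of the background `W` (`‖Z‖ ≤ α₀`).  THIS FILE proves that SHAPE, with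
every letter discharged by name and ONE explicit `τ`, for the representatives that PRESERVE THE TOP DATUM (`cavgIter (k+1) (We^{Z}) = cavgIter (k+1) W`) — the class the
memo's located point singles out (for the others the transport's defect `2dωC_F` is `M^{d−1}` too large).  The relative link radius of the pair `(We^{Z}, W)` is
`‖e^{Z} − 1‖ ≤ e^{α₀} − 1`, both lie in the class at the common radius `x′ = x + 4(e^{α₀} − 1)` (`smallField_vary`), F73 gives `Λ`, F72 gives `C_F` (unused at `ω = 0` but
required by F74's signature), F74 transports.  CURRENCY: `τ = x′·c₁·(M^d∕M²)·M^{1−d}·O(L^{d−2}·M(e^{α₀}−1) + L^{d−3}·M²x′)`; with `α₀ = α̂∕M`, `x = b∕M²`: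
`K_G·τ ≍ M·(δ′∕M²)·c₁·O(α̂ + b′)∕M² ≍ δ′·c₁·O(α̂ + b′)∕M³`… i.e. `τ·K_G = O((α̂ + b)·δ′)∕M²·(1∕M)⁰` — of the closing order `small·δ∕M²` (memo §2), level-uniform.
WHAT ([folklore]; 0 def, 0 sorry).  **`hTT_sameTop`** — the statement in the title, hypotheses: `W` unitary `(N·L^{k+1})`-periodic, `SmallField W x`, `LevelSmall d L k x′` and
route Π's W5∕W6 lines at `x′`, `2 ≤ d`, `2 ≤ L`.
HONEST FRAMING (page 1): composition; the fibre-preserving (pointed) Landau representative is NOT constructed (memo §3 (i): «REP WITH A FIXED TOP»); (APE) on curved data NOT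
proved; NOT ONE-STEP, NOT NE7; spine 0∕9; finite T⁴ rung (B)+1 — NOT infinite volume, NOT mass gap, NOT `BetaPertH`, NOT Clay.  Continuum YM on T⁴ ⇐ BetaPertH ∧ nine spine
estimates (0/9 proved); BetaPertH ⇐ (D1) ∧ (D4) ∧ CAP+tail; G-an2-4 gates asym, D1 and NE2/3/4.
-/

set_option autoImplicit false

open scoped BigOperators Matrix.Norms.L2Operator
open NormedSpace Finset

namespace Summit.QuantumFields.BalabanUV.T4Continuum.NE7TangentTransportSameTopDocked

open Literature.MathematicalPhysics.QuantumFieldTheory.Balaban1983to89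
open B7Prop1Explicit B7Prop2Explicit MatrixLog UnitaryModel
open T4AveragingDeficitWall (IsUnitaryCfg IsSkewDir SmallField Ad dirL1 vary)
open T4AveragingDeficitWallBoundary (IsPeriodicCfg periodBox)
open AveragingDeficitPeriodicCounting (IsPeriodicDir)
open AveragingDeficitTwoLevelPrep (prop1Radius twoLevelSmall)
open AveragingDeficitMultiLevelPrep (cavgIter LevelSmall)
open AveragingDeficitPlaqDeriv (vary_isUnitaryCfg)
open MinimalActionLevels (perWin)
open BlockAverageVaryHolo (nbRad)
open NE3TangentCovariantTower (dirIter QbarIter framePotW)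
open NE3HessForm (dAction)
open NE3QbarIterCovLiftPrep (cruxC)
open NE3RightInverseSolveLetters (thetaLoc)
open NE3HatInvCurlLetters (curl1C curl1C_nonneg)
open NE3EnergyVary (smallField_vary)
open NE3QuadRemainderTower (vary_add_period)
open NE7TopMismatchLetters (tangent_transport_sameTop_rightInvW)
open NE7QbarCurvedBaseBudget (sum_norm_QbarIter_sub_QbarIter_le_budget)
open NE7FramePotCurvedL1 (sum_norm_framePotW_le_Kmaj)

noncomputable section

variable {d : ℕ} {n : Type*} [Fintype n] [DecidableEq n]

/-- **THE (L4) LETTER OF THE CURVED (APE) FOR FIBRE-PRESERVING REPRESENTATIVES, DISCHARGED** (statement in the module docstring). [folklore] -/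
theorem hTT_sameTop [Nonempty n] (hd : 2 ≤ d) {L : ℕ} (hL : 2 ≤ L) (k : ℕ) {N : ℕ} [NeZero N]
    {W : Site d → Fin d → (Matrix n n ℂ)ˣ} {x α₀ : ℝ} (hWu : IsUnitaryCfg W) (hWP : IsPeriodicCfg W ((N * L ^ (k + 1) : ℕ) : ℤ))
    (hx : 0 ≤ x) (hα0 : 0 ≤ α₀) (hWx : SmallField W x)
    (hs' : LevelSmall d L k (x + 4 * (Real.exp α₀ - 1)))
    (hθ : cruxC d L * (((L : ℝ) ^ (k + 1)) ^ 2 * (x + 4 * (Real.exp α₀ - 1))) < 1)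
    (hθl : thetaLoc d L * (((L : ℝ) ^ (k + 1)) ^ 2 * (x + 4 * (Real.exp α₀ - 1))) < 1)
    (hε : ((L : ℝ) ^ (k + 1)) ^ 2 * (x + 4 * (Real.exp α₀ - 1)) ≤ 1) :
    ∀ Z : Site d → Fin d → Matrix n n ℂ, IsSkewDir Z → IsPeriodicDir Z ((N * L ^ (k + 1) : ℕ) : ℤ) → (∀ y μ, ‖Z y μ‖ ≤ α₀) →
      cavgIter L (k + 1) (vary W Z 1) = cavgIter L (k + 1) W →
      ∀ Y : Site d → Fin d → Matrix n n ℂ, IsSkewDir Y → IsPeriodicDir Y ((N * L ^ (k + 1) : ℕ) : ℤ) → dirIter L (k + 1) W Y = 0 →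
        ∃ Y' : Site d → Fin d → Matrix n n ℂ, IsSkewDir Y' ∧ IsPeriodicDir Y' ((N * L ^ (k + 1) : ℕ) : ℤ) ∧ dirIter L (k + 1) (vary W Z 1) Y' = 0 ∧
          |dAction (vary W Z 1) (fun y μ => Y' y μ - Y y μ) (perWin d (N * L ^ (k + 1)))|
            ≤ ((x + 4 * (Real.exp α₀ - 1))
                * ((curl1C d L / (1 - thetaLoc d L * (((L : ℝ) ^ (k + 1)) ^ 2 * (x + 4 * (Real.exp α₀ - 1)))))
                    * (((L : ℝ) ^ (k + 1)) ^ d / ((L : ℝ) ^ (k + 1)) ^ 2))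
                * (Real.exp (((L : ℝ) ^ d / L) * ((d : ℝ) * (16 * ((d : ℝ) + 1) * ((d : ℝ) + 4) * (L : ℝ) ^ 2)
                      * (1250 * ((nbRad d L : ℝ) + L) + 8 * ((d : ℝ) * L) + 2 * L)) * (2 / twoLevelSmall d L))
                    * ((L : ℝ) / (L : ℝ) ^ d) ^ k
                    * (((d : ℝ) * (2 * nbRad d L + 1) ^ d) * ((2 * (d : ℝ) + 4) * (L : ℝ) ^ 2) * (2 * (L : ℝ) ^ k) * (Real.exp α₀ - 1)
                      + (17 / 8 * ((L : ℝ) ^ 2) ^ k * (x + 4 * (Real.exp α₀ - 1)))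
                        * (((d : ℝ) * (2 * nbRad d L + 1) ^ d) * ((2 * (d : ℝ) + 4)
                              * (2 * (2 * L * (nbRad d L : ℝ) + 128 * ((d : ℝ) + 1) * ((d : ℝ) + 4) * (L : ℝ) ^ 2)))
                          + ((d : ℝ) * (2 * nbRad d L + 1) ^ d) * ((2 * (d : ℝ) + 4) * (L : ℝ) ^ 2 * (2 * (nbRad d L : ℝ))
                              + 2 * (8 * (L : ℝ) + (1250 * ((nbRad d L : ℝ) + L) + 8 * (d * L) + 2 * L))
                                  * (16 * ((d : ℝ) + 1) * ((d : ℝ) + 4) * (L : ℝ) ^ 2))))))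
              * dirL1 Y (periodBox (d := d) (N * L ^ (k + 1))) := by
  intro Z hZs hZP hZα hTop Y hY hYP hYT
  set x' : ℝ := x + 4 * (Real.exp α₀ - 1) with hx'
  have he0 : 0 ≤ Real.exp α₀ - 1 := by have := Real.add_one_le_exp α₀; linarith
  have hx'0 : 0 ≤ x' := by rw [hx']; positivity
  have hxx' : x ≤ x' := by rw [hx']; linarith
  -- the representative `U = W e^{Z}`: unitary, periodic, in the class at the common radius `x′`
  set U : Site d → Fin d → (Matrix n n ℂ)ˣ := vary W Z 1 with hU
  have hUu : IsUnitaryCfg U := vary_isUnitaryCfg hWu hZs 1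
  have hUP : IsPeriodicCfg U ((N * L ^ (k + 1) : ℕ) : ℤ) := vary_add_period hWP hZP 1
  have hUx' : SmallField U x' := by rw [hU, hx']; exact smallField_vary hWu hWx hZs hZα
  have hWx' : SmallField W x' := fun y κ κ' hne => (hWx y κ κ' hne).trans hxx'
  -- the relative link radius of the pair: `‖W⁻¹U − 1‖ = ‖e^{Z} − 1‖ ≤ e^{α₀} − 1`
  have hr₀ : ∀ (y : Site d) (μ : Fin d), ‖(((W y μ)⁻¹ * U y μ : (Matrix n n ℂ)ˣ) : Matrix n n ℂ) - 1‖ ≤ Real.exp α₀ - 1 := by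
    intro y μ
    have e1 : (W y μ)⁻¹ * U y μ = expUnit (((1 : ℝ) : ℂ) • Z y μ) := by rw [hU]; unfold vary; rw [inv_mul_cancel_left]
    rw [e1, val_expUnit]
    refine B7Transfer.norm_exp_sub_one_le_of_le _ ?_
    rw [Complex.ofReal_one, one_smul]; exact hZα y μ
  -- the letters: `Λ` by F73, `C_F` by F72
  have hΛ := fun (Y₂ : Site d → Fin d → Matrix n n ℂ) (_ : IsSkewDir Y₂) (hY₂P : IsPeriodicDir Y₂ ((N * L ^ (k + 1) : ℕ) : ℤ))
      (_ : dirIter L (k + 1) W Y₂ = 0) =>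
    sum_norm_QbarIter_sub_QbarIter_le_budget (d := d) hL k hUu hWu hx'0 hs' hUx' hWx' hUP hWP he0 hr₀ hY₂P
  have hF := fun (Y₂ : Site d → Fin d → Matrix n n ℂ) (_ : IsSkewDir Y₂) (hY₂P : IsPeriodicDir Y₂ ((N * L ^ (k + 1) : ℕ) : ℤ))
      (_ : dirIter L (k + 1) W Y₂ = 0) =>
    sum_norm_framePotW_le_Kmaj (d := d) hd hL k hWu hx'0 hs' hWx' hY₂P
  -- F74 at equal tops
  exact tangent_transport_sameTop_rightInvW hL k hUu hWu hUP hWP hx'0 hs' hUx' hWx' hθ hθl hε hx'0 hUx' hTop hF hΛ Y hY hYP hYT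

end

end Summit.QuantumFields.BalabanUV.T4Continuum.NE7TangentTransportSameTopDocked
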